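/-
Origin: expansion seat `prover-pub-hodgecm-own-htheta-g2-0`, handover #H29 2026-08-21T13:47:42Z md5 86d28c9dd58a (125 l.; NEW additive MODEL leaf — `_ge` twin(s) D8: Gen12PinsP2.real34_R2C_of_GOG_T_ge; imports Binders.Real34PinsROGT2 + #H21; author item6-p2 (prover-pub-hodgecm2-item6-p2-0) under own-htheta; nothing cited, NOT an E term; sha256 2e583cd25377df8dd2b9349253abf011658789c54162b1e9f12d4e5ca7662102; CERT rc 0 + trio as in the header; NAMES for audit: HodgeCM.Model.Gen12PinsP2.real34_R2C_of_GOG_T_ge ) (`HOME/pub-hodgecm-own-htheta/stage80/HodgeCM/Model/Binders/Real34PinsROGT2Ge.lean`, md5 86d28c9dd58a, 125 lines);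
landed by the p-seat packager p gen 32 (p-g32) in gate run 79 as `HodgeCM/Model/Binders/Real34PinsROGT2Ge.lean` (verbatim).
-/
/-
Copyright (c) 2026 the pub-hodgecm formalisation cell (harness21).  New file, not vendored.
Origin: seat `prover-pub-hodgecm2-item6-p2-0` (unit pub-hodgecm2-item6-p2, TRANSPOSITION item (vi) extra prover p2 queued behind the own-htheta
lineage; coordinator ruling 2026-08-21T13:01:49Z), 2026-08-21 — own-htheta g2 ROUND-2 assignment pub-hodgecm STATUS l.15865 13:09:09Z «(vi-2) D-HEAD
`_ge` TWINS», BATCH 1 (assigned there to item6-p1, who took the tree-side S2 glue instead — pub-hodgecm2/transposition/item-6/p1/STATUS.md 13:29:30Z;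
taken over by p2 so that the D5–D17 twin chain is complete for one cut; hodge-director/ITEM6-SPLIT.md (vi-2)/(vi-4); x2 `D-HEADS-THREADING.md`
8761fc1d3358; x2 `E-HEADS-FACE-BLUEPRINT.md` v1.1 fc085fc795dd §1 rows `gen12`/`real34`).  Target in PKG: `HodgeCM/Model/Binders/Real34PinsROGT2Ge.lean` (NEW additive
leaf beside `HodgeCM/Model/Binders/Real34PinsROGT2.lean`, installed md5 dcc5509dd830; imports `HodgeCM.Model.Binders.Real34PinsROGT2` + `HodgeCM.Model.ThetaSpaceInputPinGe`; nothing of record imports it).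
KERNEL ONLY: theorems, no proof holes, nothing cited, no hypothesis kind of E, no `def`; nothing here is a claim of the manuscripts under adjudication;
HC_CM is NOT proved.

WHAT IT IS — the `_ge` twin(s) of D8 `real34_R2C_of_GOG_T` (`Binders/Real34PinsROGT2.lean`:99; POINTWISE form — the face-usable one: `hU₂ hU₃ CT` at the context are explicit). NOT twinned: D9 `real34_R2CET` (:137), whose proof threads E's triple into the A-chain head `thetaSub_of_factOG` (`E2InstanceOGR8.lean`:46, slot `hLiu`) — at a face that slot is #H19/#H20/#H22 (own-htheta/x1), not a token edit; a face A1 calls `real34_R2C_of_GOG_T_ge` directly with `hU₂ hU₃` from #H22: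
statements VERBATIM with the sextic guard `(hK : Module.finrank ℚ c.K = 6)` replaced by `(hK : 6 ≤ Module.finrank ℚ c.K)` (what a rank-four face of a
Galois CM field `F` of degree ≥ 6 supplies at `c.K := F`), proofs = the originals' with the regime proof `isAnisotropic_of_goodCtx V hc hK` replaced by `isAnisotropic_of_goodCtx_ge V hc hK` in BOTH places it occurs — the body (:127) AND the type of the hypothesis `CT : Real34CensusSideT … V c (…)` (:117); the two `Real34CensusSideT` types are definitionally equal (the regime argument is a proof of a `Prop`), so E's `CT` terms are accepted unchanged.
E's sextic heads are the instances `hK := h6.ge` (`Model.six_le_of_finrank_eq_six`, `ThetaSpaceInputPinGe.lean`:76).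
Generated from the installed original by `work/gen_twins_b1.py` (token edits listed in `work/gen_twins_b1.report`); section variables byte-identical.
-/
import Summits.HodgeConjecture.HodgeCM.Model.Binders.Real34PinsROGT2
import Summits.HodgeConjecture.HodgeCM.Model.ThetaSpaceInputPinGe

/-! PORT of `HodgeCM/Model/Binders/Real34PinsROGT2Ge.lean` (HodgeCMPerL run 82) — verbatim mechanical port; provenance in the PORT header line. -/

set_option autoImplicit false

noncomputable section

open MeasureTheory NumberField

namespace HodgeCM.Model

open HodgeCM HodgeCM.Universe HodgeCM.Adelic
open Literature.NumberTheory.Weil1964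
open Literature.NumberTheory.Automorphic (piSchwartzBruhat archWeight)
open Literature.NumberTheory.GelbartRogawski1991.UnitaryDualPair
open Literature.AlgebraicGeometry.HodgeTheory
open Literature.NumberTheory.Automorphic.PicardCM
open Literature.NumberTheory.Transcendental (Arapura2012_Cor_15_4_6)
open HodgeCM.CMTypeOps (inflate)
open HodgeCM.Model.ThetaSpace
open HodgeCM.Model.ArchSideTerm

namespace Gen12PinsP2

variable
  (hGR : ∀ {L : CMField} {ι₁ : L →+* ℂ} (V : HermSpace3 L ι₁) (c : SeesawCtx L),
    (cmSplittingDatum (L : Type) finProdFinEquiv (frameD V) (frameD_real V) (frameD_ne V) (dW c.D) (dW_real c.D)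
      (dW_ne c.D)).CompatibleSplitting)
  (hGR₀ : ∀ {L : CMField} {ι₁ : L →+* ℂ} (V : HermSpace3 L ι₁) (c : SeesawCtx L),
    (cmSplittingDatum (L : Type) (e₁) (frameD V) (frameD_real V) (frameD_ne V) (lineVec (L : Type) (dW c.D 0))
      (fun _ => dW_real c.D 0) (fun _ => dW_ne c.D 0)).CompatibleSplitting)
  (hGR₁ : ∀ {L : CMField} {ι₁ : L →+* ℂ} (V : HermSpace3 L ι₁) (c : SeesawCtx L),
    (cmSplittingDatum (L : Type) (e₁) (frameD V) (frameD_real V) (frameD_ne V) (lineVec (L : Type) (dW c.D 1))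
      (fun _ => dW_real c.D 1) (fun _ => dW_ne c.D 1)).CompatibleSplitting)
  (hGR₂ : ∀ {L : CMField} {ι₁ : L →+* ℂ} (V : HermSpace3 L ι₁) (c : SeesawCtx L),
    (cmSplittingDatum (L : Type) (e₁) (frameD V) (frameD_real V) (frameD_ne V) (lineVec (L : Type) (dW' c.D 0))
      (fun _ => dW'_real c.D 0) (fun _ => dW'_ne c.D 0)).CompatibleSplitting)
  (hGR₃ : ∀ {L : CMField} {ι₁ : L →+* ℂ} (V : HermSpace3 L ι₁) (c : SeesawCtx L),
    (cmSplittingDatum (L : Type) (e₁) (frameD V) (frameD_real V) (frameD_ne V) (lineVec (L : Type) (dW' c.D 1))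
      (fun _ => dW'_real c.D 1) (fun _ => dW'_ne c.D 1)).CompatibleSplitting)
  (μ : ∀ {L : CMField}, SeesawCtx L → Fin 4 → NumberField.InfinitePlace (L : Type) → ℤ)
  (hΔ₁ : ∀ {L : CMField} {ι₁ : L →+* ℂ} (V : HermSpace3 L ι₁) (c : SeesawCtx L), ∀ hc : SInstance.GOG V c,
    slotTypeVec V c (hGR V c) (hGR₀ V c) (hGR₁ V c) (hGR₂ V c) (hGR₃ V c) (SInstance.hG_GOG V c hc) 1 -
      slotTypeVec V c (hGR V c) (hGR₀ V c) (hGR₁ V c) (hGR₂ V c) (hGR₃ V c) (SInstance.hG_GOG V c hc) 0 = μ c 1 - μ c 0)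
  (hΔ₂ : ∀ {L : CMField} {ι₁ : L →+* ℂ} (V : HermSpace3 L ι₁) (c : SeesawCtx L), ∀ hc : SInstance.GOG V c,
    slotTypeVec V c (hGR V c) (hGR₀ V c) (hGR₁ V c) (hGR₂ V c) (hGR₃ V c) (SInstance.hG_GOG V c hc) 2 -
      slotTypeVec V c (hGR V c) (hGR₀ V c) (hGR₁ V c) (hGR₂ V c) (hGR₃ V c) (SInstance.hG_GOG V c hc) 0 = μ c 2 - μ c 0)
  (hΔ₃ : ∀ {L : CMField} {ι₁ : L →+* ℂ} (V : HermSpace3 L ι₁) (c : SeesawCtx L), ∀ hc : SInstance.GOG V c,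
    slotTypeVec V c (hGR V c) (hGR₀ V c) (hGR₁ V c) (hGR₂ V c) (hGR₃ V c) (SInstance.hG_GOG V c hc) 3 -
      slotTypeVec V c (hGR V c) (hGR₀ V c) (hGR₁ V c) (hGR₂ V c) (hGR₃ V c) (SInstance.hG_GOG V c hc) 0 = μ c 3 - μ c 0)

variable (hHD : exists_isReal_hodgeModel) (hI : hodgePQ_independent_of_hodgeModel)
  (h₁ : BallQuotientUniformised)  (h₃ : CMAbelianVarietyRealised)
  (h : Bool) (hA : Arapura2012_Cor_15_4_6)

/- the pins, spelled out: η_S := `@EtaChi.η (@SInstance.χVR @hGR @hGR₀ @hGR₁) (@SInstance.χWR @hGR @hGR₀ @hGR₁ @μ)` (likewise `hη_S`, `hηc_S`),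
   W := `Gen12Pins.Wg @hGR η_S hη_S hηc_S @Gen12Pins.τSyl @Gen12Pins.TSyl @Gen12Pins.hTSyl` (= `HypCensus.Wcm hGR η_S hη_S hηc_S`, rfl),
   S := `SInstance.SROGT'C @hGR @hGR₀ @hGR₁ @hGR₂ @hGR₃ @μ hΔ₁ hΔ₂ hΔ₃`
     (= `SInstance.SGPT' @SInstance.GOG @SInstance.hG_GOG @hGR η_S hη_S hηc_S @νR @hνR @hνcR @ν'R @hν'R @hν'cR @hGR₀..₃ @(SInstance.ART' … @SInstance.hpos_GOG hΔ₁ hΔ₂ hΔ₃)`, rfl). -/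



section Pointwise

variable {L : CMField} {ι₁ : L →+* ℂ} (V : HermSpace3 L ι₁) (c : SeesawCtx L)

/-- `_ge` TWIN of `real34_R2C_of_GOG_T` (guard `6 ≤ [c.K:ℚ]` in place of `= 6`; statement otherwise verbatim, proof = the original's with the `_ge` callee). **Row 17 ON THE GUARD at glue-1's S pin `SROG`, from the (34) CENSUS SIDE UP TO PERIOD EQUIVALENCE** (pointwise; bit `h` free; the SATISFIABLE twin of #39 `real34_ROG_of_GOG`): at a good sextic context with
`hg : GOG V c`, C3₂,₃ `hU₂ hU₃` at the context and ONE `Gen12PinsP2.Real34CensusSideT` (mc-binder-2's (34) census core at the W pin ⊕ `hwedgeT`: every inserted printed vector has,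
character by character, the (34) period of an admissible wedge sum of `SROG V c`), E's `Real34FunBridge V c` for
the model at `W := Wg @hGR @η_S @hη_S @hηc_S @τSyl @TSyl @hTSyl`, `S := SROG …` is inhabited.  (L3), (N1)₂,₃, the see-saw junctions and the universe
facts are all discharged below this line (`real34_totalKSTAt`). -/
theorem real34_R2C_of_GOG_T_ge (hg : SInstance.GOG V c)
    (hc : (pinT hHD hI h₁ h₃ h hA
      (Gen12Pins.Wg @hGR (@EtaChi.η (@SInstance.χVR @hGR @hGR₀ @hGR₁) (@SInstance.χWR @hGR @hGR₀ @hGR₁ @μ)) (@EtaChi.hη (@SInstance.χVR @hGR @hGR₀ @hGR₁) (@SInstance.χWR @hGR @hGR₀ @hGR₁ @μ))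
        (@EtaChi.hηc (@SInstance.χVR @hGR @hGR₀ @hGR₁) (@SInstance.χWR @hGR @hGR₀ @hGR₁ @μ)) @Gen12Pins.τSyl @Gen12Pins.TSyl @Gen12Pins.hTSyl)
      (SInstance.SROGT'C @hGR @hGR₀ @hGR₁ @hGR₂ @hGR₃ @μ hΔ₁ hΔ₂ hΔ₃) μ).GoodCtx ι₁ c)
    (hK : 6 ≤ Module.finrank ℚ c.K)
    (hU₂ : ∀ Γ : Level V, (pinT hHD hI h₁ h₃ h hA
      (Gen12Pins.Wg @hGR (@EtaChi.η (@SInstance.χVR @hGR @hGR₀ @hGR₁) (@SInstance.χWR @hGR @hGR₀ @hGR₁ @μ)) (@EtaChi.hη (@SInstance.χVR @hGR @hGR₀ @hGR₁) (@SInstance.χWR @hGR @hGR₀ @hGR₁ @μ))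
        (@EtaChi.hηc (@SInstance.χVR @hGR @hGR₀ @hGR₁) (@SInstance.χWR @hGR @hGR₀ @hGR₁ @μ)) @Gen12Pins.τSyl @Gen12Pins.TSyl @Gen12Pins.hTSyl)
      (SInstance.SROGT'C @hGR @hGR₀ @hGR₁ @hGR₂ @hGR₃ @μ hΔ₁ hΔ₂ hΔ₃) μ).Theta V c 2 Γ ⊆ (picardCMUniverse hHD hI h₁ h₃).Uiso Γ c.K (c.Ψ 2) c.σ)
    (hU₃ : ∀ Γ : Level V, (pinT hHD hI h₁ h₃ h hA
      (Gen12Pins.Wg @hGR (@EtaChi.η (@SInstance.χVR @hGR @hGR₀ @hGR₁) (@SInstance.χWR @hGR @hGR₀ @hGR₁ @μ)) (@EtaChi.hη (@SInstance.χVR @hGR @hGR₀ @hGR₁) (@SInstance.χWR @hGR @hGR₀ @hGR₁ @μ))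
        (@EtaChi.hηc (@SInstance.χVR @hGR @hGR₀ @hGR₁) (@SInstance.χWR @hGR @hGR₀ @hGR₁ @μ)) @Gen12Pins.τSyl @Gen12Pins.TSyl @Gen12Pins.hTSyl)
      (SInstance.SROGT'C @hGR @hGR₀ @hGR₁ @hGR₂ @hGR₃ @μ hΔ₁ hΔ₂ hΔ₃) μ).Theta V c 3 Γ ⊆ (picardCMUniverse hHD hI h₁ h₃).Uiso Γ c.K (c.Ψ 3) c.σ)
    (CT : Real34CensusSideT @SInstance.GOG @SInstance.hG_GOG @hGR (@EtaChi.η (@SInstance.χVR @hGR @hGR₀ @hGR₁) (@SInstance.χWR @hGR @hGR₀ @hGR₁ @μ))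
      (@EtaChi.hη (@SInstance.χVR @hGR @hGR₀ @hGR₁) (@SInstance.χWR @hGR @hGR₀ @hGR₁ @μ)) (@EtaChi.hηc (@SInstance.χVR @hGR @hGR₀ @hGR₁) (@SInstance.χWR @hGR @hGR₀ @hGR₁ @μ)) (@SInstance.νR @hGR₁) (@SInstance.hνR @hGR₁) (@SInstance.hνcR @hGR₁) (@SInstance.ν'R @hGR₃) (@SInstance.hν'R @hGR₃) (@SInstance.hν'cR @hGR₃) @hGR₀ @hGR₁ @hGR₂ @hGR₃
      (@SInstance.ART' @SInstance.GOG @SInstance.hG_GOG @hGR (@SInstance.χVR @hGR @hGR₀ @hGR₁) (@SInstance.νR @hGR₁) (@SInstance.ν'R @hGR₃) @hGR₀ @hGR₁ @hGR₂ @hGR₃ @μ @SInstance.hpos_GOG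
        (fun V c hc => hΔ₁ V c hc) (fun V c hc => hΔ₂ V c hc) (fun V c hc => hΔ₃ V c hc))
      hHD hI h₁ h₃ h hA @μ V c (isAnisotropic_of_goodCtx_ge V hc hK)) :
    Nonempty ((pinT hHD hI h₁ h₃ h hA
      (Gen12Pins.Wg @hGR (@EtaChi.η (@SInstance.χVR @hGR @hGR₀ @hGR₁) (@SInstance.χWR @hGR @hGR₀ @hGR₁ @μ)) (@EtaChi.hη (@SInstance.χVR @hGR @hGR₀ @hGR₁) (@SInstance.χWR @hGR @hGR₀ @hGR₁ @μ))
        (@EtaChi.hηc (@SInstance.χVR @hGR @hGR₀ @hGR₁) (@SInstance.χWR @hGR @hGR₀ @hGR₁ @μ)) @Gen12Pins.τSyl @Gen12Pins.TSyl @Gen12Pins.hTSyl)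
      (SInstance.SROGT'C @hGR @hGR₀ @hGR₁ @hGR₂ @hGR₃ @μ hΔ₁ hΔ₂ hΔ₃) μ).Real34FunBridge V c) :=
  real34_totalKSTAt @SInstance.GOG @SInstance.hG_GOG @hGR (@EtaChi.η (@SInstance.χVR @hGR @hGR₀ @hGR₁) (@SInstance.χWR @hGR @hGR₀ @hGR₁ @μ))
    (@EtaChi.hη (@SInstance.χVR @hGR @hGR₀ @hGR₁) (@SInstance.χWR @hGR @hGR₀ @hGR₁ @μ)) (@EtaChi.hηc (@SInstance.χVR @hGR @hGR₀ @hGR₁) (@SInstance.χWR @hGR @hGR₀ @hGR₁ @μ))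
    (@SInstance.νR @hGR₁) (@SInstance.hνR @hGR₁) (@SInstance.hνcR @hGR₁) (@SInstance.ν'R @hGR₃) (@SInstance.hν'R @hGR₃) (@SInstance.hν'cR @hGR₃) @hGR₀ @hGR₁ @hGR₂ @hGR₃
    (@SInstance.ART' @SInstance.GOG @SInstance.hG_GOG @hGR (@SInstance.χVR @hGR @hGR₀ @hGR₁) (@SInstance.νR @hGR₁) (@SInstance.ν'R @hGR₃) @hGR₀ @hGR₁ @hGR₂ @hGR₃ @μ @SInstance.hpos_GOG
      (fun V c hc => hΔ₁ V c hc) (fun V c hc => hΔ₂ V c hc) (fun V c hc => hΔ₃ V c hc))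
    hHD hI h₁ h₃ h hA @μ V c (isAnisotropic_of_goodCtx_ge V hc hK) hg hc (fun k _ => (ArchSideTerm.archLineInputT'_w V c.D _ _ _ _ _ _ _ _ k _).trans (ArchSideTerm.archLineInputOf_w _ k)) hU₂ hU₃ CT

end Pointwise

end Gen12PinsP2

end HodgeCM.Model

end
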